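import Literature.MathematicalPhysics.QuantumFieldTheory.Balaban1983to89.Node00.TorusCoverCubeMemberPrint

/-!
# NODE 00 — [15] (144) «□̃ ⊂ Ω_{j−1}» FOR THE PRINT DATUM OF A GRID CUBE MEETING `Ω_j` (NOT NECESSARILY INSIDE IT): the collar-projection clause `hcollar` of the
# (152)∕(153) door `exists_localGauge152_RE153_coverBox_propCubeP_of_prop6P` from a `Within`-witness — the BOUNDARY DATUMS of the S6 head (grid cubes based outside `Ω_j`
# carrying plaquettes ∕ bonds of the level-`j` clause), print p. 300: «a cube □ intersecting Ω_j»

Cell `pub-ymgap`, width seat `pub-ymgap-dag-n07-w4` gen 3 (director-ym №197 ∕ HUMAN RULING D-0149); node N07 = [15] = [Balaban1985Variational]; [6] = [Balaban1985RegularSpaces];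
INTENT-3 of 2026-08-28 (bus I.30627, LOCATED-BOUNDARY-DATUM).  `--kind proof --supports stmt-QuantumFields-20542`; count-neutral; theorems only, no `def`.  The PRINT-DATUM twin of
this seat's g0 FILE `Node00.TorusCoverCollarOfMeets` (p592904: the same clause for FILE 26's datum `cubeIdx'`, corner `M·a`).  CONSUMED BY NAME, nothing restated: n07-e's 36a
`Node00.TorusCoverCubeMemberPrint` (`cubeIdxP'`, `propCubeP`, `cornerP`, `sideP`, ★ `exists_mem_box_within_of_mem_Ω_cubeIdxP'`), FILE 26 `Node00.TorusCoverCubeMember`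
(`cubeExt_side_eq_box`, `cover_mem_of_within_of_seqSeparated`), FILE 29 `Node00.TorusCoverGaugeTokensR` (`cover_mem_hullD_one_of_within`), lit's `B14DomainGeom.Within`,
`B14.Eq213MaximalDomains.side ∕ cubeExt`, def-P11's `Sect2.SeqSeparated`, def-R's `hullD`, r15's `cover`.

WHY.  Print p. 300: *«Let us take a cube □ intersecting Ω_j but not Ω_{j+1}, of a size 2ML^jη … □_j ⊂ B_{j−1}(Λ_{j−1}) ∪ B_j(Λ_j) and □̃ ⊂ B_{j−1}(Λ_{j−1}) ∪ B_j(Λ_j) ⊂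
Ω_{j−1}»* (144), and the class is read on `□̃` at the level-`(j−1)` radius: *«U′_k satisfies the conditions (2) on □̃ with L²ε₀η² on the right-hand side»*.  The big cube of the
one-step improvement MEETS `Ω_j`; it need not lie inside it.  In the tree the level-`n` clause of `HalvingStepTop(Core)` ranges over `Sect2.omegaPlaqsTop s.Ω Ω₀ n = plaqsOf (s.Ω n)`
(SOME corner in `Ω_n`), so a plaquette `p` with `p.src ∉ Ω_n`, `p.src + e_μ ∈ Ω_n` carries the level-`n` radius while the only datum box containing it — that of the grid cube
of `p.src` (this seat's p606159) — belongs to a grid cube DISJOINT from `Ω_n`: a BOUNDARY DATUM.  The S3 door of record (n07-w3 `gauge152_RE153_box_of_prop6P`, 36a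
`cover_image_Ω_cubeIdxP'_subset`) asks `hΩ : cubeEnl (side L M n) a 0 ⊆ s.Ω n` and does not serve boundary datums; but `hΩ` is used there ONLY to derive the collar clause
`hcollar : π '' (cubeIdxP' …).Ω 0 ⊆ Ω_{n−1}` (resp. the support at `n = 1`), and the underlying door `exists_localGauge152_RE153_coverBox_propCubeP_of_prop6P` (n07-w3 p606569)
takes `hcollar` as a HYPOTHESIS and already reads the class at `L³·ε(n−1)`.  THIS FILE supplies `hcollar` from the `Within`-witness of this seat's per-datum tokens
(`DatumGauge165TopStepCore` ∕ `DatumGaugeSplitTopStepCore`: a point `x` of the grid cube within `Dw` of a lift `y` of a site of `Ω_n`): every level of the member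
`cubeIdxP' P n _ M ρ a` lies within `(11d + 4ρ)Lⁿ` of the grid box (36a), the grid box has diameter `LⁿM − 1`, so the member lies within `(11d + 4ρ + M + Dw)·Lⁿ − 1` of `y`,
inside print's separation layer `LⁿM₁` around `Ω_n ⊆ Ω_{n−1}` (floor `11d + 4ρ + M + Dw ≤ M₁`; at `n = 1` the support's layer of `M₁`-cubes, floor `(11d + 4ρ + M)·L + Dw ≤ M₁`).

CONTENTS.  ★ `Sect2.cover_image_Ω_cubeIdxP'_subset_of_within_mem` (`2 ≤ n ≤ k`) · ★ `Sect2.cover_image_Ω_cubeIdxP'_one_subset_hullD_of_within_mem` (`n = 1`) ·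
★★ `Sect2.hcollar_cubeIdxP'_of_within_mem` (both cases in the hypothesis shape of `exists_localGauge152_RE153_coverBox_propCubeP_of_prop6P`, `Ω₀ := hullD P M₁ 1 (s.Ω 1)`,
one floor `(11d + 4ρ + M + Dw)·L ≤ M₁`).  §3 (EDITION v1.1, 2026-08-28, bus I.31743; §1–§2 byte-identical to v1.0 p612582): ★★ `Sect2.cover_mem_Ω_pred_of_near_box_propCubeP`
(every point within `E·Lⁿ` of the print box projects into `Ω_{n−1}`, floor `11d + 2ρ + M + Dw + E ≤ M₁` — the head's window lies `E·Lⁿ` deep in `Ω_{n−1}`, hence inside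
an `E·Lⁿ`-eroded record family `Ω♭_{n−1}` of n07-e's 44C∕(δ)).

HONEST FRAMING: integer bookkeeping on box coordinates + print's separation by name; nothing of [15]∕[6] asserted; [6] Prop. 6 on print's class stays a displayed HYPOTHESIS
elsewhere; tokens NOT discharged; stub 1 ∕ K0⁷ ∕ K1⁷ NOT closed; N07 NOT discharged; counts unmoved (typed 28∕28 · discharged 5∕27); one finite 𝕋⁴ programme at fixed ε — R4 closes the
conditional finite-𝕋⁴ rung `BalabanLadder.UV` ONLY; the YM mass gap (Clay) is NOT proved by any of this; nothing continuum ∕ ℝ⁴ ∕ OS.  No `def`, no `instance`, no `notation`, no `sorry`.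
-/

noncomputable section

namespace Literature.MathematicalPhysics.QuantumFieldTheory.Balaban1983to89.Node00

open B15Eq112TorusCover (cover)
open B14DomainGeom (Pt Within)
open B14.Eq213MaximalDomains (side cubeExt)
open B8Eq131Cubes (box)

variable {P : Params}

/-! ## §1  The member of a grid cube meeting `Ω_n` projects into `Ω_{n−1}` (`2 ≤ n`) ∕ into the support (`n = 1`) -/

/-- Two points of one grid cube `cubeExt S a 0` are within `S − 1` of each other (sup-distance). [folklore] -/
private theorem within_of_mem_cubeExt' {S : ℕ} {a x x' : Pt P.d} (hx : x ∈ cubeExt S a 0) (hx' : x' ∈ cubeExt S a 0) :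
    Within ((S : ℤ) - 1) x' x := fun i => by
  have h1 := hx i; have h2 := hx' i
  simp only [sub_zero, add_zero] at h1 h2
  rw [abs_le]; constructor <;> linarith [h1.1, h1.2, h2.1, h2.2]

/-- **THE REACH OF THE PRINT MEMBER FROM A WITNESS**: every point `z` of any level `(cubeIdxP' P n _ M ρ a).Ω j` of the print member of the grid cube `a` lies within
`(11d + 4ρ)·Lⁿ + (LⁿM − 1) + Dw` of any point `y` within `Dw` of a point `x` of that grid cube (36a `exists_mem_box_within_of_mem_Ω_cubeIdxP'` + two triangle inequalities).
[cite: Balaban1985Variational, (144) p.300; Balaban1985RegularSpaces, p.98] -/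
private theorem within_of_mem_Ω_cubeIdxP'_of_within {n : ℕ} (hn : 1 ≤ n) {M ρ : ℕ} (hM : 1 ≤ M) (hρ : P.L ≤ ρ) {a x y : Pt P.d}
    (hx : x ∈ cubeExt (side P.L M n) a 0) {Dw : ℕ} (hxy : Within (Dw : ℤ) x y) {j : ℕ} {z : Pt P.d} (hz : z ∈ (cubeIdxP' P n hn M ρ a).Ω j) :
    Within ((((11 * P.d + 4 * ρ) * P.L ^ n : ℕ) : ℤ) + (((side P.L M n : ℕ) : ℤ) - 1) + (Dw : ℤ)) z y := by
  obtain ⟨y', hy', hzy'⟩ := exists_mem_box_within_of_mem_Ω_cubeIdxP' hn hM hρ a hz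
  rw [← cubeExt_side_eq_box] at hy'
  exact (hzy'.triangle (within_of_mem_cubeExt' hx hy')).triangle hxy

/-- ★ **[15] (144) «□̃ ⊂ Ω_{j−1}» FOR THE PRINT DATUM OF A GRID CUBE MEETING `Ω_n`, `2 ≤ n ≤ k`** (print p. 300: «a cube □ intersecting Ω_j»): for a SEPARATED sequence
(`Sect2.SeqSeparated M₁ s`: one layer of side-`LⁿM₁` cubes around `Ω_n` inside `Ω_{n−1}`), a grid cube `cubeExt (LⁿM) a` with a point `x` within `Dw` of a lift `y` of a site of
`Ω_n`, and the floor `11d + 4ρ + M + Dw ≤ M₁`, EVERY level of the print member `cubeIdxP' P n _ M ρ a` (36a: corner `cornerP` on the `ρ`-grid, side `sideP ≤ M + 11d + 2ρ`, collar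
`2ρ`) projects into `Ω_{n−1}` — the `hcollar` hypothesis of n07-w3's `exists_localGauge152_RE153_coverBox_propCubeP_of_prop6P` at a boundary datum.  (36a's
`cover_image_Ω_cubeIdxP'_subset` is the case `x = y`, cube inside `Ω_n`.)
[cite: Balaban1985Variational, (144) p.300, p.302; Balaban1985RegularSpaces, p.98, (1.3)–(1.6) p.77; Balaban1988Convergent, (2.13) p.256] -/
theorem Sect2.cover_image_Ω_cubeIdxP'_subset_of_within_mem {D : ℕ → Set (Set (Site P 0))} {k M₁ : ℕ} (hM₁ : 1 ≤ M₁) (s : B14.Eq218Concrete.Seq D k)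
    (hsep : Sect2.SeqSeparated M₁ s) {ρ : ℕ} (hρ : P.L ≤ ρ) {M : ℕ} (hM : 1 ≤ M) {Dw : ℕ} (hfloor : 11 * P.d + 4 * ρ + M + Dw ≤ M₁) {n : ℕ} (hn : 2 ≤ n)
    (hnk : n ≤ k) {a x y : Pt P.d} (hx : x ∈ cubeExt (side P.L M n) a 0) (hy : cover P y ∈ s.Ω n) (hxy : Within (Dw : ℤ) x y) (j : ℕ) :
    cover P '' (cubeIdxP' P n (by omega) M ρ a).Ω j ⊆ s.Ω (n - 1) := by
  rintro _ ⟨z, hz, rfl⟩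
  have hw := within_of_mem_Ω_cubeIdxP'_of_within (by omega) hM hρ hx hxy hz
  obtain ⟨m, rfl⟩ : ∃ m, n = m + 1 := ⟨n - 1, by omega⟩
  rw [Nat.add_sub_cancel]
  refine cover_mem_of_within_of_seqSeparated hM₁ s hsep (by omega) (by omega) hy (hw.mono ?_)
  rw [side, side]
  have hL : (1 : ℤ) ≤ (P.L : ℤ) ^ (m + 1) := by exact_mod_cast Nat.one_le_pow _ _ P.L_pos
  have hf : ((11 * P.d + 4 * ρ + M + Dw : ℕ) : ℤ) ≤ M₁ := by exact_mod_cast hfloor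
  push_cast at hf ⊢
  nlinarith

/-- ★ **AT SCALE `n = 1` THE MEMBER OF A GRID CUBE MEETING `Ω₁` PROJECTS INTO THE SUPPORT** `hullD P M₁ 1 (Ω 1)` ([III] p. 255: `Ω₁` + one layer of scale-0 `M₁`-cubes), floor
`(11d + 4ρ + M)·L + Dw ≤ M₁` (36a's `cover_image_Ω_cubeIdxP'_one_subset_hullD` is the case `x = y`).
[cite: Balaban1988Convergent, p.255, (2.13) p.256; Balaban1985Variational, (144) p.300; Balaban1985RegularSpaces, p.98] -/
theorem Sect2.cover_image_Ω_cubeIdxP'_one_subset_hullD_of_within_mem {M₁ ρ : ℕ} (hρ : P.L ≤ ρ) {Ω : ℕ → Set (Site P 0)} {M : ℕ} (hM : 1 ≤ M) {Dw : ℕ}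
    (hfloor : (11 * P.d + 4 * ρ + M) * P.L + Dw ≤ M₁) {a x y : Pt P.d} (hx : x ∈ cubeExt (side P.L M 1) a 0) (hy : cover P y ∈ Ω 1)
    (hxy : Within (Dw : ℤ) x y) (j : ℕ) :
    cover P '' (cubeIdxP' P 1 le_rfl M ρ a).Ω j ⊆ hullD P M₁ 1 (Ω 1) := by
  rintro _ ⟨z, hz, rfl⟩
  have hw := within_of_mem_Ω_cubeIdxP'_of_within le_rfl hM hρ hx hxy hz
  have hM₁ : 0 < M₁ := by
    have h1 : 1 ≤ (11 * P.d + 4 * ρ + M) * P.L := Nat.one_le_iff_ne_zero.mpr (Nat.mul_ne_zero (by omega) (by have := P.hL.2; omega))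
    omega
  refine cover_mem_hullD_one_of_within hM₁ hy (hw.mono ?_)
  rw [side, pow_one]
  have hf : (((11 * P.d + 4 * ρ + M) * P.L + Dw : ℕ) : ℤ) ≤ M₁ := by exact_mod_cast hfloor
  push_cast at hf ⊢
  nlinarith

/-! ## §2  The `hcollar` hypothesis of the (152)∕(153) door, both cases -/

/-- ★★ **THE COLLAR CLAUSE OF THE (152)∕(153) DOOR AT A DATUM MEETING `Ω_n`, IN THE DOOR'S OWN SHAPE**: for `1 ≤ n ≤ k`, a separated sequence, a grid cube of level `n`
with a point within `Dw` of a lift of a site of `Ω_n`, and the single floor `(11d + 4ρ + M + Dw)·L ≤ M₁`, the level-`0` set of the print member projects into `Ω_{n−1}` for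
`n ≥ 2` and into the support `hullD P M₁ 1 (Ω 1)` for `n = 1` — verbatim the hypothesis `hcollar` of n07-w3's `exists_localGauge152_RE153_coverBox_propCubeP_of_prop6P` with
`Ω₀ := hullD P M₁ 1 (s.Ω 1)` (= `suppDomOfRecord` of record by `suppDomOfRecord_eq`).  With it the S3 gauge of the one-step improvement exists on the window `π '' box(propCubeP …)`
of EVERY datum the per-datum tokens of the S6 head ask about (boundary datums included), under [6] Prop. 6 on print's class.
[cite: Balaban1985Variational, (144) p.300 («a cube □ intersecting Ω_j»), (152) p.301, p.302; Balaban1985RegularSpaces, p.98, Prop. 6 p.99; Balaban1988Convergent, p.255, (2.13) p.256] -/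
theorem Sect2.hcollar_cubeIdxP'_of_within_mem {D : ℕ → Set (Set (Site P 0))} {k M₁ : ℕ} (hM₁ : 1 ≤ M₁) (s : B14.Eq218Concrete.Seq D k)
    (hsep : Sect2.SeqSeparated M₁ s) {ρ : ℕ} (hρ : P.L ≤ ρ) {M : ℕ} (hM : 1 ≤ M) {Dw : ℕ} (hfloor : (11 * P.d + 4 * ρ + M + Dw) * P.L ≤ M₁) {n : ℕ} (hn : 1 ≤ n)
    (hnk : n ≤ k) {a x y : Pt P.d} (hx : x ∈ cubeExt (side P.L M n) a 0) (hy : cover P y ∈ s.Ω n) (hxy : Within (Dw : ℤ) x y) :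
    cover P '' (cubeIdxP' P n hn M ρ a).Ω 0 ⊆ (if n - 1 = 0 then hullD P M₁ 1 (s.Ω 1) else s.Ω (n - 1)) := by
  rcases Nat.eq_or_lt_of_le hn with h1 | h1
  · subst h1
    rw [if_pos rfl]
    refine Sect2.cover_image_Ω_cubeIdxP'_one_subset_hullD_of_within_mem hρ hM ?_ hx hy hxy 0
    have : Dw ≤ Dw * P.L := Nat.le_mul_of_pos_right Dw P.L_pos
    nlinarith
  · rw [if_neg (by omega)]
    refine Sect2.cover_image_Ω_cubeIdxP'_subset_of_within_mem hM₁ s hsep hρ hM ?_ h1 hnk hx hy hxy 0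
    exact le_trans (Nat.le_mul_of_pos_right _ P.L_pos) hfloor

/-! ## §3  (v1.1) A margin around the print box: every point within `E·Lⁿ` of the box projects into `Ω_{n−1}` -/

/-- **A POINT OF THE PRINT BOX IS WITHIN `(M + 11d + 2ρ)·Lⁿ` OF ANY POINT OF ITS GRID CUBE** (coordinatewise: the box `[Lⁿ·cornerP, Lⁿ(cornerP + sideP) − 1]` starts
less than `ρ` grid-units below the grid cube `[Lⁿ·M·a, Lⁿ(M·a + M) − 1]` and is at most `M + 11d + 2ρ` grid-units long — 36a `lt_gridFloor_add`, `gridFloor_le`, `sideP_le`).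
[cite: Balaban1985Variational, (144) p.300; Balaban1985RegularSpaces, p.98 (bookkeeping)] -/
private theorem within_of_mem_box_propCubeP_of_mem_cubeExt {n M ρ : ℕ} (hρ : P.L ≤ ρ) {a x y' : Pt P.d}
    (hx : x ∈ cubeExt (side P.L M n) a 0) (hy' : y' ∈ box P.L (cornerP P M ρ a) (sideP P M ρ) n) :
    Within ((((M + 11 * P.d + 2 * ρ) * P.L ^ n : ℕ) : ℤ)) y' x := by
  have hρ0 : 0 < ρ := lt_of_lt_of_le P.L_pos hρ
  have hL0 : (0 : ℤ) ≤ (P.L : ℤ) ^ n := by positivity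
  intro i
  have h1 := hx i
  have h2 := hy' i
  simp only [sub_zero, add_zero] at h1
  simp only [B8Eq131Cubes.bLo, B8Eq131Cubes.bHi, Nat.cast_zero, sub_zero, add_zero] at h2
  have hc1 : cornerP P M ρ a i ≤ (M : ℤ) * a i := gridFloor_le hρ0 _
  have hc2 : (M : ℤ) * a i < cornerP P M ρ a i + ρ := lt_gridFloor_add hρ0 _
  have hS : ((sideP P M ρ : ℕ) : ℤ) ≤ ((M + 11 * P.d + 2 * ρ : ℕ) : ℤ) := by exact_mod_cast sideP_le (P := P) M ρ
  have hside : ((side P.L M n : ℕ) : ℤ) = (P.L : ℤ) ^ n * M := by rw [side]; push_cast; ring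
  rw [hside] at h1
  push_cast at hS h2 ⊢
  -- the products with `Lⁿ ≥ 0`
  have p1 : (P.L : ℤ) ^ n * cornerP P M ρ a i ≤ (P.L : ℤ) ^ n * ((M : ℤ) * a i) := mul_le_mul_of_nonneg_left hc1 hL0
  have p2 : (P.L : ℤ) ^ n * ((M : ℤ) * a i) ≤ (P.L : ℤ) ^ n * (cornerP P M ρ a i + ρ) := mul_le_mul_of_nonneg_left hc2.le hL0
  have p3 : (P.L : ℤ) ^ n * ((sideP P M ρ : ℕ) : ℤ) ≤ (P.L : ℤ) ^ n * ((M : ℤ) + 11 * (P.d : ℤ) + 2 * (ρ : ℤ)) := mul_le_mul_of_nonneg_left hS hL0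
  rw [abs_le]
  constructor <;> nlinarith [h1.1, h1.2, h2.1, h2.2, p1, p2, p3, hL0]

/-- ★★ **EVERY POINT WITHIN `E·Lⁿ` OF THE PRINT BOX OF A GRID CUBE MEETING `Ω_n` PROJECTS INTO `Ω_{n−1}`** (`2 ≤ n ≤ k`): for a separated sequence, a grid cube with a point
within `Dw` of a lift of a site of `Ω_n`, and the floor `11d + 2ρ + M + Dw + E ≤ M₁`, every `z` within sup-distance `E·Lⁿ` of a point of `box L (cornerP M ρ a) (sideP M ρ) n`
satisfies `π z ∈ Ω_{n−1}` — the box sits at least `E·Lⁿ` DEEP inside `Ω_{n−1}`.  With a record family ERODED by `E·Lⁿ` at level `n − 1` (the `Ω♭` of n07-e's 44C∕(δ):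
`D″ = domainsMeet (cubeDomains …) (domainsOfSeq Ω♭ …)`), this is «the S6 head's window lies in `Ω♭_{n−1}`», i.e. its cells have `D″`-level `n` or `n − 1` — the hypothesis
`hY : ∀ x ∈ Y, D″.InOm (n − 1) x` of `letters10On_of_weightedRowsNearTop` (p615261) at `ℓ = 1`.
[cite: Balaban1985Variational, (144) p.300 («□̃ ⊂ … ⊂ Ω_{j−1}»), (150) p.301, p.302; Balaban1985RegularSpaces, p.98, (1.3)–(1.6) p.77; Balaban1988Convergent, (2.13) p.256] -/
theorem Sect2.cover_mem_Ω_pred_of_near_box_propCubeP {D : ℕ → Set (Set (Site P 0))} {k M₁ : ℕ} (hM₁ : 1 ≤ M₁) (s : B14.Eq218Concrete.Seq D k)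
    (hsep : Sect2.SeqSeparated M₁ s) {ρ : ℕ} (hρ : P.L ≤ ρ) {M : ℕ} {Dw E : ℕ} (hfloor : 11 * P.d + 2 * ρ + M + Dw + E ≤ M₁) {n : ℕ} (hn : 2 ≤ n)
    (hnk : n ≤ k) {a x y : Pt P.d} (hx : x ∈ cubeExt (side P.L M n) a 0) (hy : cover P y ∈ s.Ω n) (hxy : Within (Dw : ℤ) x y) {z y' : Pt P.d}
    (hy' : y' ∈ box P.L (cornerP P M ρ a) (sideP P M ρ) n) (hz : Within (((E * P.L ^ n : ℕ) : ℤ)) z y') : cover P z ∈ s.Ω (n - 1) := by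
  have hw := (hz.triangle (within_of_mem_box_propCubeP_of_mem_cubeExt hρ hx hy')).triangle hxy
  obtain ⟨m, rfl⟩ : ∃ m, n = m + 1 := ⟨n - 1, by omega⟩
  rw [Nat.add_sub_cancel]
  refine cover_mem_of_within_of_seqSeparated hM₁ s hsep (by omega) (by omega) hy (hw.mono ?_)
  rw [side]
  have hL : (1 : ℤ) ≤ (P.L : ℤ) ^ (m + 1) := by exact_mod_cast Nat.one_le_pow _ _ P.L_pos
  have hf : ((11 * P.d + 2 * ρ + M + Dw + E : ℕ) : ℤ) ≤ M₁ := by exact_mod_cast hfloor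
  push_cast at hf ⊢
  nlinarith

end Literature.MathematicalPhysics.QuantumFieldTheory.Balaban1983to89.Node00

end
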